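import Mathlib
import Literature.Analysis.Complex.CauchyTransformHolder
import Literature.Analysis.Complex.CauchyTransformHolderExtension
import Literature.Analysis.Complex.CauchyTransformHolderHigher
import Literature.Geometry.Symplectic.JHolomorphicRegularityHolderAux
import Summits.SmoothPoincare4.SmoothPoincare4.Theorems.SullivanDualTameOrBrodyR4CoreAChart
import Summits.SmoothPoincare4.SmoothPoincare4.Theorems.SullivanDualTameOrBrodyR4HelperConjugatedEquation

/-!
# Zeros of the vorticity map: regularity, flatness, asymptotics (stub `helper_zerosAnalytic`,
# line Sketch)

Crux `stmt-SmoothPoincare4-7826` (`TameOrBrodyR4`), line `Sketch`, CORE-A (the implicit function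
theorem chart `CoreA.ChartData` at a pencil member `u₀` of asymptotic value `b₀`). A zero `(β, g)`
of the vorticity map, `g ∈ C^{0,r}_b(ℂ, ℂ²)`, `|β|` and `‖g‖` small, defines
`W = (0, β) + T(χ₁ g)` (`T` the Cauchy transform) and the normal graph `U = u₀ + Ψ W`. This file is
the ANALYTIC half of "small zeros are pencil members":

* `T(χ₁ g)` is `C¹` with `r`-Hölder derivative, all three norms `≤ K ‖g‖`, `∂̄ T(χ₁ g) = χ₁ g`,
  and `T(χ₁ g) → 0` at infinity (`ZerosAnalytic.transform_package`, from the Hölder estimate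
  `cauchyTransform_holder_of_apriori` and `tendsto_cauchyTransform_cocompact`);
* hence `U` is `C¹` with locally `r`-Hölder derivative (`ZerosAnalytic.regularity`, product rule);
* the zero equation is, where `χ = 1`, one half of the conjugated Cauchy–Riemann equation of
  `helper_conjugatedEquation`, and where `χ ≠ 1` both the coefficient `A` and the `J`-difference
  vanish (`J` is standard far out), so `U` is flat-`J`-holomorphic (`ZerosAnalytic.flat`);
* `W → (0, β)` at infinity and `Ψ` is the standard frame far out, so `Q ∘ U → b₀ + β` and
  `P ∘ U - id → 0` (`ZerosAnalytic.asymptotics`).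
-/

-- the registered namespace `Summit.SmoothPoincare4.SmoothPoincare4.…` repeats a component
set_option linter.dupNamespace false

noncomputable section

open scoped ContDiff Topology NNReal
open Filter Set Metric Literature.Analysis.Complex Literature.Analysis.FunctionSpaces
  Literature.Geometry.Symplectic

namespace Summit.SmoothPoincare4.SmoothPoincare4.Cruxes.TameOrBrodyR4.Sketch

/-- Local notation for the model space `ℝ⁴ = EuclideanSpace ℝ (Fin 4)`. -/
local notation "E4" => EuclideanSpace ℝ (Fin 4)

namespace ZerosAnalytic

variable {J : E4 → E4 →L[ℝ] E4} {R : ℝ} {P Q : E4 →L[ℝ] ℂ} {eP eQ : ℂ →L[ℝ] E4} {b₀ : ℂ}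
  {u₀ : ℂ → E4}

/-- **The cut-off Cauchy transform package.** There is `K ≥ 0` (depending on the chart and `r`)
such that for every `g ∈ C^{0,r}_b(ℂ, ℂ²)` the Cauchy transform `V = T(χ₁ g)` is `C¹`,
`∂̄ V = χ₁ g`, `‖V‖, ‖DV‖ ≤ K ‖g‖`, `DV` is `r`-Hölder with constant `K ‖g‖`, and `V → 0` at
infinity. -/
theorem transform_package (𝒞 : CoreA.ChartData J R P Q eP eQ b₀ u₀) {r : ℝ≥0} (hr0 : 0 < r)
    (hr1 : r < 1) :
    ∃ K : ℝ, 0 ≤ K ∧ ∀ g : ContDiffHolderFunction ℂ (ℂ × ℂ) 0 r,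
      ContDiff ℝ 1 (cauchyTransformAlong (1 : ℂ) (fun w => 𝒞.χ₁ w • g w)) ∧
      (∀ z, dbarAlong (1 : ℂ) (cauchyTransformAlong (1 : ℂ) (fun w => 𝒞.χ₁ w • g w)) z =
        𝒞.χ₁ z • g z) ∧
      (∀ z, ‖cauchyTransformAlong (1 : ℂ) (fun w => 𝒞.χ₁ w • g w) z‖ ≤ K * ‖g‖) ∧
      (∀ z, ‖fderiv ℝ (cauchyTransformAlong (1 : ℂ) (fun w => 𝒞.χ₁ w • g w)) z‖ ≤ K * ‖g‖) ∧
      (∀ z z', ‖fderiv ℝ (cauchyTransformAlong (1 : ℂ) (fun w => 𝒞.χ₁ w • g w)) z -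
          fderiv ℝ (cauchyTransformAlong (1 : ℂ) (fun w => 𝒞.χ₁ w • g w)) z'‖ ≤
        K * ‖g‖ * ‖z - z'‖ ^ (r : ℝ)) ∧
      Tendsto (cauchyTransformAlong (1 : ℂ) (fun w => 𝒞.χ₁ w • g w)) (cocompact ℂ) (𝓝 0) := by
  have hρ : 0 < 𝒞.ρ₁ + 3 := by linarith [𝒞.hρ₁]
  obtain ⟨C, hC0, hC⟩ := cauchyTransform_holder_of_apriori (ℂ × ℂ) hr0 hr1
    (cauchyTransformHolderApriori_of_lt_one (ℂ × ℂ) hr0 hr1) (𝒞.ρ₁ + 3) hρ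
  set Mχ := (ContDiffHolderFunction.coeffCLM (k := 0) hr1.le 𝒞.χ₁ 𝒞.hχ₁ 𝒞.hχ₁s :
    ContDiffHolderFunction ℂ (ℂ × ℂ) 0 r →L[ℝ] ContDiffHolderFunction ℂ (ℂ × ℂ) 0 r)
  refine ⟨2 * C * ‖Mχ‖, by positivity, fun g => ?_⟩
  have hkapp : ∀ z, 𝒞.χ₁ z • g z = Mχ g z := fun z => rfl
  have hkz : ∀ z, 𝒞.ρ₁ + 3 ≤ ‖z‖ → 𝒞.χ₁ z • g z = 0 := fun z hz => by
    rw [𝒞.hχ₁_zero z hz, zero_smul]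
  have hK₀ : ∀ z, ‖𝒞.χ₁ z • g z‖ ≤ ‖Mχ g‖ := fun z => by
    rw [hkapp]; exact (Mχ g).norm_apply_le_norm z
  have hK₁ : ∀ z z', ‖𝒞.χ₁ z • g z - 𝒞.χ₁ z' • g z'‖ ≤ ‖Mχ g‖ * ‖z - z'‖ ^ (r : ℝ) :=
    fun z z' => by rw [hkapp, hkapp]; exact CoreA.norm_sub_le_norm_mul_rpow (Mχ g) z z'
  obtain ⟨h1, h2, h3, h4, h5⟩ := hC (fun w => 𝒞.χ₁ w • g w) (𝒞.hχ₁.continuous.smul g.continuous)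
    hkz ‖Mχ g‖ ‖Mχ g‖ (norm_nonneg _) (norm_nonneg _) hK₀ hK₁
  have hkn : ‖Mχ g‖ ≤ ‖Mχ‖ * ‖g‖ := Mχ.le_opNorm g
  have hkn' : C * ‖Mχ g‖ ≤ C * (‖Mχ‖ * ‖g‖) := mul_le_mul_of_nonneg_left hkn hC0
  have hnn : 0 ≤ C * (‖Mχ‖ * ‖g‖) := by positivity
  have hb1 : C * ‖Mχ g‖ ≤ 2 * C * ‖Mχ‖ * ‖g‖ := by linarith
  have hb2 : C * (‖Mχ g‖ + ‖Mχ g‖) ≤ 2 * C * ‖Mχ‖ * ‖g‖ := by linarith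
  refine ⟨h1, h2, fun z => (h3 z).trans hb1, fun z => (h4 z).trans hb2, fun z z' =>
    (h5 z z').trans (mul_le_mul_of_nonneg_right hb2 (Real.rpow_nonneg (norm_nonneg _) _)),
    tendsto_cauchyTransform_cocompact hρ hkz hK₀⟩

/-- A `C¹` map is `s`-Hölder (`s ≤ 1`) on every unit disc. -/
theorem holderOn_of_contDiff {X : Type*} [NormedAddCommGroup X] [NormedSpace ℝ X] {F : ℂ → X}
    (hF : ContDiff ℝ 1 F) {s : ℝ} (hs : s ≤ 1) (z₀ : ℂ) :
    ∃ C, ∀ z ∈ ball z₀ 1, ∀ z' ∈ ball z₀ 1, ‖F z - F z'‖ ≤ C * ‖z - z'‖ ^ s := by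
  obtain ⟨b, hb⟩ := (isCompact_closedBall z₀ 1).exists_bound_of_continuousOn
    (hF.continuous_fderiv one_ne_zero).continuousOn
  exact ⟨b * (2 * 1) ^ (1 - s), fun z hz z' hz' => holder_on_ball_of_norm_fderiv_le
    (fun w _ => hF.differentiable one_ne_zero w) hs
    (fun w hw => hb w (ball_subset_closedBall hw)) hz hz'⟩

/-- Smoothness of `z ↦ (L z).flip (w z)` for smooth `L` and `w`. -/
theorem contDiff_flip_apply {X Y Z : Type*} [NormedAddCommGroup X] [NormedSpace ℝ X]
    [NormedAddCommGroup Y] [NormedSpace ℝ Y] [NormedAddCommGroup Z] [NormedSpace ℝ Z]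
    {n : WithTop ℕ∞} {L : ℂ → X →L[ℝ] Y →L[ℝ] Z} {w : ℂ → Y} (hL : ContDiff ℝ n L)
    (hw : ContDiff ℝ n w) : ContDiff ℝ n fun z => (L z).flip (w z) := by
  have h : ContDiff ℝ n
      (ContinuousLinearMap.flipₗᵢ ℝ X Y Z : (X →L[ℝ] Y →L[ℝ] Z) → (Y →L[ℝ] X →L[ℝ] Z)) :=
    LinearIsometryEquiv.contDiff _
  exact (h.comp hL).clm_apply hw

/-- The product rule for differences of compositions:
`‖A ∘ B - A' ∘ B'‖ ≤ ‖A - A'‖ ‖B‖ + ‖A'‖ ‖B - B'‖`. -/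
theorem norm_comp_sub_comp_le {X Y Z : Type*} [NormedAddCommGroup X] [NormedSpace ℝ X]
    [NormedAddCommGroup Y] [NormedSpace ℝ Y] [NormedAddCommGroup Z] [NormedSpace ℝ Z]
    (A A' : Y →L[ℝ] Z) (B B' : X →L[ℝ] Y) :
    ‖A.comp B - A'.comp B'‖ ≤ ‖A - A'‖ * ‖B‖ + ‖A'‖ * ‖B - B'‖ := by
  have e : A.comp B - A'.comp B' = (A - A').comp B + A'.comp (B - B') := by
    rw [ContinuousLinearMap.sub_comp, ContinuousLinearMap.comp_sub]; abel
  rw [e]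
  exact norm_add_le_of_le (ContinuousLinearMap.opNorm_comp_le _ _)
    (ContinuousLinearMap.opNorm_comp_le _ _)

/-- **Regularity of the normal graph.** For `W : ℂ → ℂ²` of class `C¹` with bounded,
`s`-Hölder derivative, `U = u₀ + Ψ W` is `C¹` and `DU` is locally `s`-Hölder
(`DU = Du₀ + (DΨ) W + Ψ DW`; the first two terms are `C¹`, and `Ψ` is `C¹` and bounded). -/
theorem regularity (𝒞 : CoreA.ChartData J R P Q eP eQ b₀ u₀) (hu₀s : ContDiff ℝ ∞ u₀) {s : ℝ}
    (hs : s ≤ 1) {W : ℂ → ℂ × ℂ} (hW : ContDiff ℝ 1 W) {b H : ℝ}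
    (hb : ∀ z, ‖fderiv ℝ W z‖ ≤ b)
    (hH : ∀ z z', ‖fderiv ℝ W z - fderiv ℝ W z'‖ ≤ H * ‖z - z'‖ ^ s) :
    ContDiff ℝ 1 (fun ξ => u₀ ξ + 𝒞.Ψ ξ (W ξ)) ∧
    ∀ z₀ : ℂ, ∃ C ρ : ℝ, 0 < ρ ∧ ∀ z ∈ ball z₀ ρ, ∀ z' ∈ ball z₀ ρ,
      ‖fderiv ℝ (fun ξ => u₀ ξ + 𝒞.Ψ ξ (W ξ)) z - fderiv ℝ (fun ξ => u₀ ξ + 𝒞.Ψ ξ (W ξ)) z'‖ ≤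
        C * ‖z - z'‖ ^ s := by
  have hu₀1 : ContDiff ℝ 1 u₀ := hu₀s.of_le (by exact_mod_cast le_top)
  have hΨ1 : ContDiff ℝ 1 𝒞.Ψ := 𝒞.hΨs.of_le (by exact_mod_cast le_top)
  have hDu₀ : ContDiff ℝ 1 (fderiv ℝ u₀) :=
    (hu₀s.fderiv_right (m := ∞) le_rfl).of_le (by exact_mod_cast le_top)
  have hDΨ : ContDiff ℝ 1 (fderiv ℝ 𝒞.Ψ) :=
    (𝒞.hΨs.fderiv_right (m := ∞) le_rfl).of_le (by exact_mod_cast le_top)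
  refine ⟨hu₀1.add (hΨ1.clm_apply hW), fun z₀ => ?_⟩
  -- the derivative of the graph
  have hD : ∀ z, fderiv ℝ (fun ξ => u₀ ξ + 𝒞.Ψ ξ (W ξ)) z =
      (fderiv ℝ u₀ z + (fderiv ℝ 𝒞.Ψ z).flip (W z)) + (𝒞.Ψ z).comp (fderiv ℝ W z) := fun z => by
    have h : HasFDerivAt (fun ξ => u₀ ξ + 𝒞.Ψ ξ (W ξ))
        (fderiv ℝ u₀ z + ((𝒞.Ψ z).comp (fderiv ℝ W z) + (fderiv ℝ 𝒞.Ψ z).flip (W z))) z :=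
      (hu₀1.differentiable one_ne_zero z).hasFDerivAt.add
        ((hΨ1.differentiable one_ne_zero z).hasFDerivAt.clm_apply
          (hW.differentiable one_ne_zero z).hasFDerivAt)
    rw [h.fderiv]
    abel
  -- its `C¹` part
  have hG : ContDiff ℝ 1 fun z => fderiv ℝ u₀ z + (fderiv ℝ 𝒞.Ψ z).flip (W z) :=
    hDu₀.add (contDiff_flip_apply hDΨ hW)
  obtain ⟨C₁, hC₁⟩ := holderOn_of_contDiff hG hs z₀
  obtain ⟨C₂, hC₂⟩ := holderOn_of_contDiff hΨ1 hs z₀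
  refine ⟨C₁ + (C₂ * b + |𝒞.CΨ| * H), 1, one_pos, fun z hz z' hz' => ?_⟩
  rw [hD z, hD z']
  have hA : ‖(𝒞.Ψ z).comp (fderiv ℝ W z) - (𝒞.Ψ z').comp (fderiv ℝ W z')‖ ≤
      (C₂ * b + |𝒞.CΨ| * H) * ‖z - z'‖ ^ s :=
    calc _ ≤ ‖𝒞.Ψ z - 𝒞.Ψ z'‖ * ‖fderiv ℝ W z‖ + ‖𝒞.Ψ z'‖ * ‖fderiv ℝ W z - fderiv ℝ W z'‖ :=
          norm_comp_sub_comp_le _ _ _ _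
      _ ≤ C₂ * ‖z - z'‖ ^ s * b + |𝒞.CΨ| * (H * ‖z - z'‖ ^ s) :=
          add_le_add (mul_le_mul (hC₂ z hz z' hz') (hb z) (norm_nonneg _)
            ((norm_nonneg _).trans (hC₂ z hz z' hz')))
            (mul_le_mul ((𝒞.hΨbd z').trans (le_abs_self _)) (hH z z') (norm_nonneg _)
              (abs_nonneg _))
      _ = (C₂ * b + |𝒞.CΨ| * H) * ‖z - z'‖ ^ s := by ring
  have key : ∀ a a' c c' : ℂ →L[ℝ] E4, ‖(a + c) - (a' + c')‖ ≤ ‖a - a'‖ + ‖c - c'‖ :=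
    fun a a' c c' => by rw [add_sub_add_comm]; exact norm_add_le _ _
  calc _ ≤ _ := key _ _ _ _
    _ ≤ C₁ * ‖z - z'‖ ^ s + (C₂ * b + |𝒞.CΨ| * H) * ‖z - z'‖ ^ s :=
        add_le_add (hC₁ z hz z' hz') hA
    _ = (C₁ + (C₂ * b + |𝒞.CΨ| * H)) * ‖z - z'‖ ^ s := by ring

/-- **Flatness of the normal graph from the zero equation.** If `∂̄ W = χ₁ g`, `‖Ψ W‖ ≤ 1`, and
`(W, g)` satisfies the zero equation of the vorticity map, then `U = u₀ + Ψ W` is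
flat-`J`-holomorphic: where `χ = 1` the zero equation is half the conjugated Cauchy–Riemann
equation (`helper_conjugatedEquation`); for `‖ξ‖ > ρ₁ + 1` the coefficient `A ξ` vanishes
(`CoreA.ChartData.A_eq_zero`) and `J (U ξ) = J (u₀ ξ)` (both points lie where `J` is standard),
so the zero equation gives `g ξ = 0` and the conjugated equation holds trivially. -/
theorem flat (hR : 0 < R) (hJs : ContDiff ℝ ∞ J) (hJ2 : ∀ x v, J x (J x v) = -v)
    (hPQ : IsCoordFrame P Q eP eQ)
    (hJP : ∀ x : E4, R ≤ ‖x‖ → ∀ v, P (J x v) = Complex.I * P v)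
    (hJQ : ∀ x : E4, R ≤ ‖x‖ → ∀ v, Q (J x v) = Complex.I * Q v)
    (hu₀s : ContDiff ℝ ∞ u₀) (hu₀J : IsJHolomorphicFlat J u₀)
    (𝒞 : CoreA.ChartData J R P Q eP eQ b₀ u₀) {W : ℂ → ℂ × ℂ} (hW : ContDiff ℝ 1 W)
    (hW1 : ∀ ξ, ‖𝒞.Ψ ξ (W ξ)‖ ≤ 1) {g : ℂ → ℂ × ℂ}
    (hdbar : ∀ ξ, dbarAlong (1 : ℂ) W ξ = 𝒞.χ₁ ξ • g ξ)
    (hzero : ∀ x : ℂ, g x + 𝒞.χ x • (1 / 2 : ℝ) •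
        (𝒞.A x (W x) + 𝒞.Ψinv x ((J (u₀ x + 𝒞.Ψ x (W x)) - J (u₀ x))
          (fderiv ℝ u₀ x Complex.I + (fderiv ℝ 𝒞.Ψ x Complex.I) (W x) +
            𝒞.Ψ x (fderiv ℝ W x Complex.I)))) = 0) :
    IsJHolomorphicFlat J (fun ξ => u₀ ξ + 𝒞.Ψ ξ (W ξ)) := by
  obtain ⟨-, -, hS0⟩ := 𝒞.S_props hR hJs hJ2 hPQ hJP hJQ hu₀s hu₀J
  refine (helper_conjugatedEquation J hJs hJ2 u₀ hu₀s hu₀J 𝒞.Ψ 𝒞.Ψinv 𝒞.hΨs 𝒞.hleft 𝒞.hright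
    𝒞.hΨJ W hW).2 fun ξ => ?_
  have hz := hzero ξ
  by_cases hξ : ‖ξ‖ ≤ 𝒞.ρ₁ + 1
  · -- the inner disc: `χ = χ₁ = 1`
    rw [𝒞.hχ_one ξ hξ, one_smul] at hz
    rw [hdbar ξ, 𝒞.hχ₁_one ξ (by linarith), one_smul]
    have key : ∀ a X Y : ℂ × ℂ, a + (1 / 2 : ℝ) • (X + Y) = 0 → (2 : ℂ) • a + X + Y = 0 := by
      intro a X Y h
      have h2 : (2 : ℂ) • a + X + Y = (2 : ℝ) • (a + (1 / 2 : ℝ) • (X + Y)) := by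
        rw [smul_add, smul_smul, show (2 : ℝ) * (1 / 2) = 1 by norm_num, one_smul, two_smul,
          two_smul]
        abel
      rw [h2, h, smul_zero]
    exact key _ _ _ hz
  · -- far out: `A ξ = 0`, `J (U ξ) = J (u₀ ξ)`, hence `g ξ = 0`
    have hξ' : 𝒞.ρ₁ + 1 ≤ ‖ξ‖ := le_of_lt (not_le.mp hξ)
    have hA0 : 𝒞.A ξ = 0 := 𝒞.A_eq_zero hPQ hJP hJQ hS0 hξ'
    have hfar := 𝒞.hfar ξ (by linarith)
    have hPu := PencilDefs.norm_P_le hPQ (u₀ ξ)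
    have hx₀ : R ≤ ‖u₀ ξ‖ := by linarith
    have hx₁ : R ≤ ‖u₀ ξ + 𝒞.Ψ ξ (W ξ)‖ := by
      have h3 : ‖u₀ ξ‖ ≤ ‖u₀ ξ + 𝒞.Ψ ξ (W ξ)‖ + ‖𝒞.Ψ ξ (W ξ)‖ := by
        simpa using norm_sub_le (u₀ ξ + 𝒞.Ψ ξ (W ξ)) (𝒞.Ψ ξ (W ξ))
      linarith [hW1 ξ]
    have hJeq : J (u₀ ξ + 𝒞.Ψ ξ (W ξ)) = J (u₀ ξ) :=
      ContinuousLinearMap.ext fun v => PencilDefs.eq_of_apply_eq hPQ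
        (by rw [hJP _ hx₁ v, hJP _ hx₀ v]) (by rw [hJQ _ hx₁ v, hJQ _ hx₀ v])
    have hAW : 𝒞.Ψinv ξ ((fderiv ℝ 𝒞.Ψ ξ 1) (W ξ) +
        J (u₀ ξ) ((fderiv ℝ 𝒞.Ψ ξ Complex.I) (W ξ))) = 0 := by
      have h := congrArg (fun T : (ℂ × ℂ) →L[ℝ] (ℂ × ℂ) => T (W ξ)) hA0
      simpa [CoreA.ChartData.A] using h
    rw [hJeq, sub_self, hA0] at hz
    simp only [zero_apply, map_zero, add_zero, smul_zero] at hz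
    rw [hdbar ξ, hz, smul_zero, smul_zero, hAW, zero_add, zero_add, hJeq, sub_self,
      zero_apply, map_zero]

/-- **Asymptotics of the normal graph.** If `V → 0` at infinity then, with `W = (0, β) + V`,
`Q (u₀ + Ψ W) → b₀ + β` and `P (u₀ + Ψ W) - id → 0` at infinity (far out
`Ψ ξ y = Du₀(ξ) y.1 + eQ y.2`, `‖Du₀(ξ) y₁‖ = ‖Ψ ξ (y₁, 0)‖ ≤ C_Ψ |y₁|`, `Q eQ = id`,
`P eQ = 0`). -/
theorem asymptotics (hPQ : IsCoordFrame P Q eP eQ) (𝒞 : CoreA.ChartData J R P Q eP eQ b₀ u₀)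
    (hQ₀ : Tendsto (fun ξ => Q (u₀ ξ)) (cocompact ℂ) (𝓝 b₀))
    (hP₀ : Tendsto (fun ξ => P (u₀ ξ) - ξ) (cocompact ℂ) (𝓝 0)) (β : ℂ) {V : ℂ → ℂ × ℂ}
    (hV : Tendsto V (cocompact ℂ) (𝓝 0)) :
    Tendsto (fun ξ => Q (u₀ ξ + 𝒞.Ψ ξ (((0 : ℂ), β) + V ξ))) (cocompact ℂ) (𝓝 (b₀ + β)) ∧
    Tendsto (fun ξ => P (u₀ ξ + 𝒞.Ψ ξ (((0 : ℂ), β) + V ξ)) - ξ) (cocompact ℂ) (𝓝 0) := by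
  obtain ⟨-, -, -, hPeQ, hQeQ, -⟩ := id hPQ
  have hfar : ∀ᶠ ξ in cocompact ℂ,
      𝒞.Ψ ξ (((0 : ℂ), β) + V ξ) = fderiv ℝ u₀ ξ (V ξ).1 + eQ (β + (V ξ).2) := by
    filter_upwards [tendsto_norm_cocompact_atTop.eventually_ge_atTop 𝒞.ρ₁] with ξ hξ
    rw [𝒞.hΨfar ξ hξ]
    simp only [Prod.fst_add, Prod.snd_add, zero_add]
  have hE : Tendsto (fun ξ => fderiv ℝ u₀ ξ (V ξ).1) (cocompact ℂ) (𝓝 0) := by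
    rw [tendsto_zero_iff_norm_tendsto_zero]
    have hbd : ∀ ξ, ‖fderiv ℝ u₀ ξ (V ξ).1‖ ≤ |𝒞.CΨ| * ‖V ξ‖ := fun ξ => by
      rw [← 𝒞.hΨt]
      calc ‖𝒞.Ψ ξ ((V ξ).1, 0)‖ ≤ ‖𝒞.Ψ ξ‖ * ‖((V ξ).1, (0 : ℂ))‖ := (𝒞.Ψ ξ).le_opNorm _
        _ ≤ |𝒞.CΨ| * ‖V ξ‖ := by
          refine mul_le_mul ((𝒞.hΨbd ξ).trans (le_abs_self _)) ?_ (norm_nonneg _)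
            (abs_nonneg _)
          rw [Prod.norm_mk, norm_zero, max_eq_left (norm_nonneg _)]
          exact norm_fst_le (V ξ)
    refine squeeze_zero (fun _ => norm_nonneg _) hbd ?_
    simpa using hV.norm.const_mul |𝒞.CΨ|
  have hV2 : Tendsto (fun ξ => (V ξ).2) (cocompact ℂ) (𝓝 0) := by
    simpa using hV.snd_nhds
  constructor
  · have h : Tendsto (fun ξ => Q (u₀ ξ) + (Q (fderiv ℝ u₀ ξ (V ξ).1) + (β + (V ξ).2)))
        (cocompact ℂ) (𝓝 (b₀ + (Q 0 + (β + 0)))) :=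
      hQ₀.add (((Q.continuous.tendsto 0).comp hE).add (tendsto_const_nhds.add hV2))
    simp only [map_zero, zero_add, add_zero] at h
    refine h.congr' ?_
    filter_upwards [hfar] with ξ hξ
    rw [hξ, map_add, map_add, hQeQ]
  · have h : Tendsto (fun ξ => (P (u₀ ξ) - ξ) + P (fderiv ℝ u₀ ξ (V ξ).1)) (cocompact ℂ)
        (𝓝 (0 + P 0)) :=
      hP₀.add ((P.continuous.tendsto 0).comp hE)
    simp only [map_zero, add_zero] at h
    refine h.congr' ?_
    filter_upwards [hfar] with ξ hξ
    rw [hξ, map_add, map_add, hPeQ, add_zero]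
    abel

end ZerosAnalytic

open ZerosAnalytic in
/-- **Stub `helper_zerosAnalytic` (ZM1).** Zeros `(β, g)` of the vorticity map in the chart `𝒞`
at the member `u₀`, with `|β|, ‖g‖ < θ`, give normal graphs `U = u₀ + Ψ W`,
`W = (0, β) + T(χ₁ g)`, which are `C¹` with locally `r`-Hölder derivative, flat-`J`-holomorphic,
with the member asymptotics `Q ∘ U → b₀ + β`, `P ∘ U - id → 0`, and with `‖W‖, ‖DW‖ ≤ θ'`. -/
theorem helper_zerosAnalytic (J : E4 → E4 →L[ℝ] E4) (R : ℝ) (P Q : E4 →L[ℝ] ℂ) (eP eQ : ℂ →L[ℝ] E4)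
    (hR : 0 < R) (hJs : ContDiff ℝ ∞ J) (hJ2 : ∀ x v, J x (J x v) = -v)
    (hPQ : IsCoordFrame P Q eP eQ)
    (hJP : ∀ x : E4, R ≤ ‖x‖ → ∀ v, P (J x v) = Complex.I * P v)
    (hJQ : ∀ x : E4, R ≤ ‖x‖ → ∀ v, Q (J x v) = Complex.I * Q v)
    {r : ℝ≥0} (hr0 : 0 < r) (hr1 : r < 1)
    (b₀ : ℂ) (u₀ : ℂ → E4) (hu₀ : IsPencilMember J R P Q b₀ u₀)
    (𝒞 : CoreA.ChartData J R P Q eP eQ b₀ u₀) (θ' : ℝ) (hθ' : 0 < θ') :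
    ∃ θ > (0 : ℝ), ∀ (β : ℂ) (g : ContDiffHolderFunction ℂ (ℂ × ℂ) 0 r), ‖β‖ < θ → ‖g‖ < θ →
      (∀ x : ℂ, g x + 𝒞.χ x • (1 / 2 : ℝ) •
        (𝒞.A x (((0 : ℂ), β) + cauchyTransformAlong (1 : ℂ) (fun w => 𝒞.χ₁ w • g w) x) +
          𝒞.Ψinv x ((J (u₀ x + 𝒞.Ψ x (((0 : ℂ), β) +
              cauchyTransformAlong (1 : ℂ) (fun w => 𝒞.χ₁ w • g w) x)) - J (u₀ x))
            (fderiv ℝ u₀ x Complex.I + (fderiv ℝ 𝒞.Ψ x Complex.I)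
              (((0 : ℂ), β) + cauchyTransformAlong (1 : ℂ) (fun w => 𝒞.χ₁ w • g w) x) +
              𝒞.Ψ x (fderiv ℝ (fun y => ((0 : ℂ), β) +
                cauchyTransformAlong (1 : ℂ) (fun w => 𝒞.χ₁ w • g w) y) x Complex.I)))) = 0) →
      ContDiff ℝ 1 (fun ξ => u₀ ξ + 𝒞.Ψ ξ (((0 : ℂ), β) +
          cauchyTransformAlong (1 : ℂ) (fun w => 𝒞.χ₁ w • g w) ξ)) ∧
      (∀ z₀ : ℂ, ∃ C ρ : ℝ, 0 < ρ ∧ ∀ z ∈ ball z₀ ρ, ∀ z' ∈ ball z₀ ρ,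
        ‖fderiv ℝ (fun ξ => u₀ ξ + 𝒞.Ψ ξ (((0 : ℂ), β) +
            cauchyTransformAlong (1 : ℂ) (fun w => 𝒞.χ₁ w • g w) ξ)) z -
          fderiv ℝ (fun ξ => u₀ ξ + 𝒞.Ψ ξ (((0 : ℂ), β) +
            cauchyTransformAlong (1 : ℂ) (fun w => 𝒞.χ₁ w • g w) ξ)) z'‖ ≤ C * ‖z - z'‖ ^ (r : ℝ)) ∧
      IsJHolomorphicFlat J (fun ξ => u₀ ξ + 𝒞.Ψ ξ (((0 : ℂ), β) +
          cauchyTransformAlong (1 : ℂ) (fun w => 𝒞.χ₁ w • g w) ξ)) ∧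
      Tendsto (fun ξ => Q (u₀ ξ + 𝒞.Ψ ξ (((0 : ℂ), β) +
          cauchyTransformAlong (1 : ℂ) (fun w => 𝒞.χ₁ w • g w) ξ))) (cocompact ℂ) (𝓝 (b₀ + β)) ∧
      Tendsto (fun ξ => P (u₀ ξ + 𝒞.Ψ ξ (((0 : ℂ), β) +
          cauchyTransformAlong (1 : ℂ) (fun w => 𝒞.χ₁ w • g w) ξ)) - ξ) (cocompact ℂ) (𝓝 0) ∧
      (∀ ξ, ‖((0 : ℂ), β) + cauchyTransformAlong (1 : ℂ) (fun w => 𝒞.χ₁ w • g w) ξ‖ ≤ θ') ∧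
      (∀ ξ, ‖fderiv ℝ (fun y => ((0 : ℂ), β) +
          cauchyTransformAlong (1 : ℂ) (fun w => 𝒞.χ₁ w • g w) y) ξ‖ ≤ θ') := by
  obtain ⟨hu₀s, hu₀J, -, -, hQ₀, hP₀, -, -⟩ := id hu₀
  obtain ⟨K, hK0, hK⟩ := transform_package 𝒞 hr0 hr1
  have hr1' : (r : ℝ) ≤ 1 := by exact_mod_cast hr1.le
  -- the smallness constant
  set θ₁ := min θ' (1 / (|𝒞.CΨ| + 1)) with hθ₁def
  have hθ₁0 : 0 < θ₁ := lt_min hθ' (by positivity)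
  have hK1 : (1 + K) ≠ 0 := by positivity
  set θ := θ₁ / (1 + K) with hθdef
  have hθ0 : 0 < θ := by positivity
  have hθ1 : (1 + K) * θ = θ₁ := by rw [hθdef]; field_simp
  refine ⟨θ, hθ0, fun β g hβ hg hzero => ?_⟩
  obtain ⟨hT1, hTdbar, hT0, hTD, hTH, hTlim⟩ := hK g
  set V := cauchyTransformAlong (1 : ℂ) (fun w => 𝒞.χ₁ w • g w) with hVdef
  -- `W = (0, β) + V` is `C¹`, small with small Hölder derivative, and `∂̄ W = χ₁ g`
  have hW1 : ContDiff ℝ 1 (fun y => ((0 : ℂ), β) + V y) := contDiff_const.add hT1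
  have hKg : K * ‖g‖ ≤ K * θ := mul_le_mul_of_nonneg_left hg.le hK0
  have hWb : ∀ ξ, ‖((0 : ℂ), β) + V ξ‖ ≤ θ₁ := fun ξ =>
    calc ‖((0 : ℂ), β) + V ξ‖ ≤ ‖((0 : ℂ), β)‖ + ‖V ξ‖ := norm_add_le _ _
      _ ≤ θ + K * θ := by
          refine add_le_add ?_ ((hT0 ξ).trans hKg)
          rw [Prod.norm_mk, norm_zero, max_eq_right (norm_nonneg _)]
          exact hβ.le
      _ = θ₁ := by rw [← hθ1]; ring
  have hDWb : ∀ ξ, ‖fderiv ℝ (fun y => ((0 : ℂ), β) + V y) ξ‖ ≤ θ₁ := fun ξ => by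
    rw [fderiv_const_add]
    calc ‖fderiv ℝ V ξ‖ ≤ K * θ := (hTD ξ).trans hKg
      _ ≤ θ₁ := by rw [← hθ1]; nlinarith [hθ0.le]
  have hDWH : ∀ z z', ‖fderiv ℝ (fun y => ((0 : ℂ), β) + V y) z -
      fderiv ℝ (fun y => ((0 : ℂ), β) + V y) z'‖ ≤ K * ‖g‖ * ‖z - z'‖ ^ (r : ℝ) := fun z z' => by
    rw [fderiv_const_add, fderiv_const_add]
    exact hTH z z'
  have hdbar : ∀ ξ, dbarAlong (1 : ℂ) (fun y => ((0 : ℂ), β) + V y) ξ = 𝒞.χ₁ ξ • g ξ := fun ξ => by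
    rw [dbarAlong_apply, fderiv_const_add, ← dbarAlong_apply]
    exact hTdbar ξ
  have hΨW : ∀ ξ, ‖𝒞.Ψ ξ (((0 : ℂ), β) + V ξ)‖ ≤ 1 := fun ξ =>
    calc ‖𝒞.Ψ ξ (((0 : ℂ), β) + V ξ)‖ ≤ ‖𝒞.Ψ ξ‖ * ‖((0 : ℂ), β) + V ξ‖ := (𝒞.Ψ ξ).le_opNorm _
      _ ≤ |𝒞.CΨ| * θ₁ :=
          mul_le_mul ((𝒞.hΨbd ξ).trans (le_abs_self _)) (hWb ξ) (norm_nonneg _) (abs_nonneg _)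
      _ ≤ |𝒞.CΨ| * (1 / (|𝒞.CΨ| + 1)) := by gcongr; exact min_le_right _ _
      _ ≤ 1 := by
          rw [mul_one_div, div_le_one (by positivity)]
          linarith [abs_nonneg 𝒞.CΨ]
  have hreg := regularity 𝒞 hu₀s hr1' hW1 hDWb hDWH
  have hasy := asymptotics hPQ 𝒞 hQ₀ hP₀ β hTlim
  exact ⟨hreg.1, hreg.2, flat hR hJs hJ2 hPQ hJP hJQ hu₀s hu₀J 𝒞 hW1 hΨW hdbar hzero, hasy.1,
    hasy.2, fun ξ => (hWb ξ).trans (min_le_left _ _), fun ξ => (hDWb ξ).trans (min_le_left _ _)⟩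

end Summit.SmoothPoincare4.SmoothPoincare4.Cruxes.TameOrBrodyR4.Sketch
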